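import Summits.QuantumAdvantage.QuantumAdvantage.Theorems.LinnikCubicClassGroupsDegreeOnePrimesEscapeClassPNTSmoothed
import Literature.NumberTheory.LFunctions.RayClassExplicitFormulaBounds
import HarnessLib

/-!
# The smoothed explicit inequality for a primitive Hecke character whose L-function divides `ζ₁_N`

Topic `Summits/QuantumAdvantage/QuantumAdvantage/Theorems`, cell B2b-1 (linnik-cubic), PART A (gen 12);
helper toward the crux `DegreeOnePrimesEscape` (stmt-QuantumAdvantage-11543) of route
`LinnikCubicClassGroups` — the per-character input of the Lagarias–Montgomery–Odlyzko theorem for conjugacy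
classes INSIDE a division (LMO-PLAN M5).  HONEST FRAMING: the value of this file is a THEOREM
(kernel-checked lemma) — NOT summit progress.

For a number field `K` of degree `n_K`, a primitive ray class character `χ mod 𝔣` of sign type `p`,
non-principal off `𝔣`, with entire continuations `L`, `L̄` of `L(χ,·)`, `L(χ̄,·)`, and a number field `N` such
that every zero of `L` is a zero of `ζ₁_N = (s−1)ζ_N(s)` with at least the same multiplicity
(`ord_ρ L ≤ ord_ρ ζ₁_N` for all `ρ`; for the characters of a cyclic `N|K` this is
`Literature.NumberTheory.LFunctions.CyclicExtension.exists_primitive_heckeFactorisation`), the smoothed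
explicit formula `rcCoefFordK_eq_explicit` with the Thorner–Zaman weight `g = tzTest (log x) ε` read
two-sidedly (`norm_explicit_core`) gives

  `‖Σ_n Λ_χ(n) g(log n) + Σ_{ρ ∈ Exc} m_L(ρ) F(−ρ)‖ ≤ B + 8(log A + 6 n_K)(log x + ε) + J`,

where `Exc` is any finite set of non-trivial zeros of `L`, `B` bounds the finite partial sums
`Σ_{ρ ∉ Exc} m_{ζ₁_N}(ρ) ‖F(−ρ)‖` over the non-trivial ZEROS OF `ζ₁_N`, `A = |d_K| 𝔑𝔣`, and
`J = leftLineConst · C(n_K+1)(log A + log 4 + 1) e^{−(log x)/4 + ε/2} (2M/ε)` bounds the left-line integral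
(`norm_rcEFRemainder_tzTest_zero_le`).  So the zero sums of ALL the Hecke characters of a cyclic `N|E` are
controlled by the zero sum of the single function `ζ₁_N`, to which the tree's log-free density
(`zeroSum_dedekindZeta₁_zfr_le`), Landau–Page and Deuring–Heilbronn apply.
References: [LagariasMontgomeryOdlyzko1979, §3, §7]; [ThornerZaman2019, Lemma 4.3, §5].
-/

noncomputable section

open Complex Real MeasureTheory Set Filter Topology NumberField NumberField.InfinitePlace IsDedekindDomain
open scoped NumberField nonZeroDivisors

namespace Summit.QuantumAdvantage.QuantumAdvantage.Theorems.DegreeOnePrimesEscape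

open Literature.NumberTheory.LFunctions Literature.NumberTheory.LFunctions.NumberField
  Literature.NumberTheory.LFunctions.EntireEF Literature.NumberTheory.LFunctions.TZWeight

variable {K : Type} [Field K] [NumberField K]
variable {𝔪 : Ideal (𝓞 K)} {ψ : HeightOneSpectrum (𝓞 K) → ℂ} {p : Finset {w : InfinitePlace K // IsReal w}}

/-- An entire continuation of `L(χ, ·)` does not vanish at `2`. -/
theorem continuation_two_ne_zero_of_eq (h𝔪 : 𝔪 ≠ ⊥) (hψ : IsRayClassCharacter 𝔪 ψ)
    {L : ℂ → ℂ} (hLs : ∀ s : ℂ, 1 < s.re → L s = rayClassLSeries 𝔪 ψ s) : L 2 ≠ 0 := by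
  have h2 : (1 : ℝ) < (2 : ℂ).re := by norm_num
  have h := exp_neg_finrank_div_le_norm_rayClassLSeries h𝔪 (fun v hv ↦ (hψ.norm_eq_one v hv).le) h2
  intro h0
  rw [← hLs _ h2, h0, norm_zero] at h
  exact absurd h (not_le.mpr (Real.exp_pos _))

/-- **Domination of multiplicities transfers zeros**: if `ord_ρ L ≤ ord_ρ ζ₁_N` for all `ρ` and `L` is an
entire continuation of a ray class `L`-series, then every zero of `L` is a zero of `ζ₁_N`. -/
theorem dedekindZeta₁_eq_zero_of_dominated (h𝔪 : 𝔪 ≠ ⊥) (hψ : IsRayClassCharacter 𝔪 ψ)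
    {L : ℂ → ℂ} (hL : Differentiable ℂ L) (hLs : ∀ s : ℂ, 1 < s.re → L s = rayClassLSeries 𝔪 ψ s)
    {N : Type} [Field N] [NumberField N]
    (hdom : ∀ ρ : ℂ, analyticOrderNatAt L ρ ≤ analyticOrderNatAt (dedekindZeta₁ N) ρ)
    {ρ : ℂ} (hρ : L ρ = 0) : dedekindZeta₁ N ρ = 0 := by
  -- `L` is not locally zero at `ρ` (it is entire and `L(2) ≠ 0`), so `ord_ρ L ≥ 1`
  have htop : analyticOrderAt L ρ ≠ ⊤ := by
    intro htop
    rw [analyticOrderAt_eq_top] at htop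
    have hall := ((hL.differentiableOn.analyticOnNhd isOpen_univ).eqOn_zero_of_preconnected_of_eventuallyEq_zero
      isPreconnected_univ (Set.mem_univ ρ) htop) (Set.mem_univ (2 : ℂ))
    exact continuation_two_ne_zero_of_eq h𝔪 hψ hLs hall
  have hpos : 0 < analyticOrderNatAt L ρ := by
    have hne0 : analyticOrderAt L ρ ≠ 0 := by
      rw [ne_eq, (hL.analyticAt ρ).analyticOrderAt_eq_zero]; exact not_not.mpr hρ
    have : (analyticOrderNatAt L ρ : ℕ∞) = analyticOrderAt L ρ := by
      rw [analyticOrderNatAt, ENat.coe_toNat htop]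
    by_contra h
    push Not at h
    have h0 : analyticOrderNatAt L ρ = 0 := Nat.le_zero.mp h
    rw [h0] at this
    exact hne0 this.symm
  have hN : 0 < analyticOrderNatAt (dedekindZeta₁ N) ρ := lt_of_lt_of_le hpos (hdom ρ)
  by_contra hne
  have h0 : analyticOrderAt (dedekindZeta₁ N) ρ = 0 := by
    rw [((dedekindZeta₁_differentiable N).analyticAt ρ).analyticOrderAt_eq_zero]; exact hne
  have : analyticOrderNatAt (dedekindZeta₁ N) ρ = 0 := by rw [analyticOrderNatAt, h0]; rfl
  omega

/-- **The smoothed explicit inequality for a primitive Hecke character dominated by `ζ₁_N`** (see the module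
docstring): with `g = tzTest (log x) ε`, `F` its Laplace transform, `Exc` a finite set of non-trivial zeros of
`L`, and `B` a bound for the finite partial sums of `m_{ζ₁_N}(ρ)‖F(−ρ)‖` over the non-trivial zeros of `ζ₁_N`
outside `Exc`:
`‖K_χ(g) + Σ_{ρ ∈ Exc} m_L(ρ) F(−ρ)‖ ≤ B + 8(log A + 6n_K)(log x + ε) + leftLineConst·C(n_K+1)(log A + log 4 + 1)e^{−log x/4+ε/2}(2M/ε)`.
[cite: LagariasMontgomeryOdlyzko1979, §7] [cite: ThornerZaman2019, Lemma 4.3] -/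
theorem norm_coefFordK_rcCoef_add_exc_le (hψ : IsRayClassCharacter 𝔪 ψ) (hprim : IsPrimitive 𝔪 ψ)
    (hp : IsSignType 𝔪 ψ p) (h𝔪 : 𝔪 ≠ ⊥)
    (hnt : ∃ v : HeightOneSpectrum (𝓞 K), ¬ 𝔪 ≤ v.asIdeal ∧ ψ v ≠ 1)
    {L L' : ℂ → ℂ} (hL : Differentiable ℂ L) (hLs : ∀ s : ℂ, 1 < s.re → L s = rayClassLSeries 𝔪 ψ s)
    (hL' : Differentiable ℂ L') (hL's : ∀ s : ℂ, 1 < s.re → L' s = rayClassLSeries 𝔪 (star ψ) s)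
    {N : Type} [Field N] [NumberField N]
    (hdom : ∀ ρ : ℂ, analyticOrderNatAt L ρ ≤ analyticOrderNatAt (dedekindZeta₁ N) ρ)
    {C : ℝ} (hC0 : 0 < C)
    (hC : ∀ (K : Type) [Field K] [NumberField K] (𝔪 : Ideal (𝓞 K))
      (ψ : HeightOneSpectrum (𝓞 K) → ℂ) (p : Finset {w : InfinitePlace K // IsReal w}),
      IsRayClassCharacter 𝔪 ψ → IsPrimitive 𝔪 ψ → IsSignType 𝔪 ψ p → 𝔪 ≠ ⊥ →
      ∀ (L L' : ℂ → ℂ), Differentiable ℂ L → (∀ s : ℂ, 1 < s.re → L s = rayClassLSeries 𝔪 ψ s) →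
        Differentiable ℂ L' → (∀ s : ℂ, 1 < s.re → L' s = rayClassLSeries 𝔪 (star ψ) s) →
      ∀ t : ℝ, ‖logDeriv L (-1 / 2 + t * I)‖ ≤
        C * (Module.finrank ℚ K + 1) * (Real.log (|(discr K : ℝ)| * (Ideal.absNorm 𝔪 : ℝ)) + Real.log (|t| + 4)))
    {M : ℝ} (hM : ∀ y : ℝ, |iteratedDeriv 1 Real.smoothTransition y| ≤ M ∧ |iteratedDeriv 2 Real.smoothTransition y| ≤ M)
    {x ε : ℝ} (hx : 1 < x) (hε : 0 < ε) (hεL : ε < Real.log x / 2)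
    (Exc : Finset ℂ) (hExc : ∀ ρ ∈ Exc, L ρ = 0 ∧ 0 < ρ.re ∧ ρ.re < 1)
    {B : ℝ} (hB : ∀ u : Finset ℂ, (∀ ρ ∈ u, dedekindZeta₁ N ρ = 0 ∧ 0 < ρ.re ∧ ρ.re < 1) →
      ∑ ρ ∈ u with ρ ∉ Exc, (analyticOrderNatAt (dedekindZeta₁ N) ρ : ℝ) *
        ‖fordLaplace (tzTest (Real.log x) ε) (-ρ)‖ ≤ B) :
    ‖coefFordK (rcCoef 𝔪 ψ) (tzTest (Real.log x) ε) 0 +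
        ∑ ρ ∈ Exc, (analyticOrderNatAt L ρ : ℂ) * fordLaplace (tzTest (Real.log x) ε) (-ρ)‖ ≤
      B + 8 * (Real.log (|(discr K : ℝ)| * (Ideal.absNorm 𝔪 : ℝ)) + 6 * Module.finrank ℚ K) * (Real.log x + ε) +
        NumberField.leftLineConst * (C * (Module.finrank ℚ K + 1)) *
          (Real.log (|(discr K : ℝ)| * (Ideal.absNorm 𝔪 : ℝ)) + Real.log 4 + 1) *
          (Real.exp (-(Real.log x / 4) + ε / 2) * (2 * M / ε)) := by
  classical
  set Lx := Real.log x with hLx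
  have hLpos : 0 < Lx := Real.log_pos hx
  have hadm := isSmoothedEFTest_tzTest hLpos hε
  have hg0 : tzTest Lx ε 0 = 0 := tzTest_zero hLpos hε hεL.le
  have hF0 : ‖fordLaplace₀ (tzTest Lx ε) 0‖ ≤ Lx + ε := by
    rw [fordLaplace₀_eq_fordLaplace hg0]; exact norm_fordLaplace_tzTest_zero_le hLpos hε hεL
  -- the explicit formula at `s = 0` and the absolute convergence of the zero sum
  have hsz : ∀ ρ : ℂ, L ρ = 0 → 0 < ρ.re → ρ.re < 1 → ρ ≠ 0 := by
    intro ρ _ h1 _ h; rw [h] at h1; simp at h1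
  have hexpl := rcCoefFordK_eq_explicit hψ hprim hp h𝔪 hnt hL hLs hL' hL's hadm hg0 (s := 0)
    (by norm_num) (by norm_num) hsz
  have hsum := summable_norm_rcZeroTerm hψ hprim hp h𝔪 hnt hL hLs hL' hL's hadm (s := 0) (by norm_num) hsz
  -- the zero terms of `L` are dominated by those of `ζ₁_N`
  have hB' : ∀ u : Finset ℂ, (∀ ρ ∈ u, L ρ = 0 ∧ 0 < ρ.re ∧ ρ.re < 1) →
      ∑ ρ ∈ u with ρ ∉ Exc, (analyticOrderNatAt L ρ : ℝ) * ‖fordLaplace (tzTest Lx ε) (-ρ)‖ ≤ B := by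
    intro u hu
    refine le_trans (Finset.sum_le_sum fun ρ hρ ↦ ?_) (hB u fun ρ hρ ↦
      ⟨dedekindZeta₁_eq_zero_of_dominated h𝔪 hψ hL hLs hdom (hu ρ hρ).1, (hu ρ hρ).2⟩)
    exact mul_le_mul_of_nonneg_right (by exact_mod_cast hdom ρ) (norm_nonneg _)
  have hcore := norm_explicit_core (f := L) hg0 (Kv := coefFordK (rcCoef 𝔪 ψ) (tzTest Lx ε) 0) (main := 0)
    (J := rcEFRemainder L (tzTest Lx ε) 0) hsum (by rw [hexpl]; ring) hF0 Exc hExc hB'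
  rw [sub_zero] at hcore
  have hm₀ := analyticOrderNatAt_continuation_zero_le hψ hprim hp h𝔪 hnt hL hLs
  have hJ := norm_rcEFRemainder_tzTest_zero_le hC0 hC hψ hprim hp h𝔪 hnt hL hLs hL' hL's hM hLpos hε hεL
  have hlogA : 0 ≤ Real.log (|(discr K : ℝ)| * (Ideal.absNorm 𝔪 : ℝ)) := by
    refine Real.log_nonneg ?_
    have h1 : (1 : ℝ) ≤ |(discr K : ℝ)| := by
      have := Int.one_le_abs (discr_ne_zero K)
      rw [← Int.cast_abs]; exact_mod_cast this
    have h2 : (1 : ℝ) ≤ (Ideal.absNorm 𝔪 : ℝ) := by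
      exact_mod_cast Nat.one_le_iff_ne_zero.mpr (by rwa [ne_eq, Ideal.absNorm_eq_zero_iff])
    nlinarith
  have hm₀' : (analyticOrderNatAt L 0 : ℝ) * (Lx + ε) ≤
      8 * (Real.log (|(discr K : ℝ)| * (Ideal.absNorm 𝔪 : ℝ)) + 6 * Module.finrank ℚ K) * (Lx + ε) :=
    mul_le_mul_of_nonneg_right hm₀ (by linarith)
  linarith
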